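import Mathlib.LinearAlgebra.Charpoly.BaseChange
import Mathlib.LinearAlgebra.Eigenspace.Charpoly
import Mathlib.RingTheory.Norm.Basic
import Mathlib.RingTheory.Ideal.MinimalPrime.Localization
import Mathlib.NumberTheory.Harmonic.Bounds
import Mathlib.Analysis.Complex.ExponentialBounds
import Literature.NumberTheory.EllipticCurves.PastenSpectralDegree
import Literature.NumberTheory.EllipticCurves.PastenCongruenceModulusProofs
import Literature.NumberTheory.EllipticCurves.DeligneHeckeEigenvalueBoundProofs
import Literature.NumberTheory.EllipticCurves.NewformsMainLemmaTraceProofs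
import Literature.NumberTheory.EllipticCurves.NewformsFiniteProofs
import Literature.NumberTheory.Sieve.BombieriAsymptoticSieveShiftedPrimes
import HarnessLib

/-!
# The size of Pasten's congruence moduli `η_{[χ₀]}([χ])`: Pasten's displayed estimate
# `log η_{[χ₀]}(c) < #c (log N + 4 log N / log log N)` from Deligne's bound in weight two

Topic `NumberTheory/EllipticCurves`; a proofs-only companion (theorems only: no definition, no
named fact, nothing restated; D-0026) of `PastenSpectralDegree.lean`, proving — from the
Ramanujan–Petersson bound in weight `2` — the displayed estimate of the proof of Pasten's Thm. 7.2:

> (Pasten 2024, proof of Thm. 7.2, p. 26) for an elliptic curve of conductor `N ≥ 11` with newform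
> `f`, system `χ₀`, and every class `c ≠ [χ₀]` of systems of Hecke eigenvalues on `𝕋 = 𝕋_{1,N}`:
> *"So we get `log η_{[χ_{D,M}]}(c) < #c · (log N + 4 log N / log log N)`"*.

Here, as in `PastenSpectralDegree.lean` (module docstring, *Transcription notes*), the classes
`c ≠ [χ₀]` are the minimal primes `P ≠ 𝕀_{[χ₀]} = eigenIdeal D.f` of `𝕋 = anemicHeckeRing N 2`,
`#c` (the number of systems in the class = the degree of the field generated by the values of any
`χ ∈ c`, §4.11) is the `ℤ`-rank of `𝕋 ⧸ P ≅ χ(𝕋)`, `η_{[χ₀]}(c)` is `heckeCongruenceModulus D.f P`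
for any datum `D : ModularParametrizationData W N` of the curve, and `N ≥ 11` (proof of Cor. 5.3,
"as `N ≥ 11`"; it makes `log log N > 0`).

**History (D-0027 review, 2026-08-15).** This estimate used to be vendored as a separate named fact
`PastenShimura2024_log_heckeCongruenceModulus_lt` of `PastenSpectralDegree.lean`. Its only input
that the tree does not prove is the weight-`2` case of the (pre-existing) named fact
`Deligne1974_heckeT_eigenvalue_norm_le`; everything else is proved in this file. The separate fact
was therefore merged back into the proof obligation of its parent (`pasten_thm_7_5_explicit`,
`PastenValuationProductThm75ExplicitProofs.lean`, which now takes Deligne's fact directly): the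
three assembly theorems below carry the displayed estimate as their explicit conclusion.

Source read: H. Pasten, *Shimura curves and the abc conjecture*, arXiv:1705.09251 = J. Number
Theory 254 (2024), §7.2, proof of Thm. 7.2 (p. 26 of the arXiv version). The printed proof:
(1) take `χ ∈ c` and the newform `g` (level dividing `N`) of `χ`; (2) deleting the coefficients of
`f`, `g` not prime to `N` gives forms of level dividing `N²`, so (Sturm) some index
`n_c ≤ (N²/6) ∏_{p ∣ N}(1 + 1/p) ≤ N²(1 + log N)/6`, prime to `N`, has `a_{n_c}(f) ≠ a_{n_c}(g)`;
(3) with `P` the minimal polynomial of `χ(T_{n_c})` (`deg P ≤ #c`), Prop. 5.4 gives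
`η ∣ P(a_{n_c}(f)) ≠ 0` and **the Hasse–Weil bound on the Fourier coefficients of a normalized
eigenform of weight `2`** gives `|P(a_{n_c}(f))| ≤ (2 d(n_c) n_c^{1/2})^{#c}`; (4) Robin's divisor
bound and arithmetic give the claim.

**What is proved here, and what is not.** Step (3) uses the Ramanujan–Petersson bound in weight
`2` for *all* newforms of level dividing `N` (Eichler–Shimura–Igusa via Weil; Deligne 1974,
Thm. 8.2 in general), which in the tree is the UNPROVED named fact
`Deligne1974_heckeT_eigenvalue_norm_le` (`DeligneHeckeEigenvalueBound.lean`). Everything else is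
proved below, and the estimate follows from that named fact in one line:

* `PastenShimura2024_log_heckeCongruenceModulus_lt_of_weight_two_bound (h2)` — the estimate,
  granted `|μ| ≤ 2√p` for every eigenvalue `μ` of `T_p` (`p ∤ N`) on `S₂(Γ₀(N))` (all `N`);
* `PastenShimura2024_log_heckeCongruenceModulus_lt_of_deligne (h : Deligne1974_…)` — the estimate
  from the named fact (its weight-`2` case, `Deligne1974_heckeT_eigenvalue_norm_le.weight_two`);
* `PastenShimura2024_log_heckeCongruenceModulus_lt_of_hasseWeil (h82)` — the estimate, granted
  exactly the input the printed proof names, *"the Hasse-Weil bound on the Fourier coefficients of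
  a normalized eigenform of weight `2`"*: `|a_p(g)| ≤ 2√p` for every newform `g ∈ S₂(Γ₀(M))` (every
  `M ≥ 1`) and every prime `p ∤ M` — the weight-`2` case of Deligne's Thm. 8.2 (Eichler 1954,
  Shimura 1958, Igusa 1959, via Weil), turned into `h2` by the tree's Atkin–Lehner transport
  `Deligne1974_heckeT_eigenvalue_norm_le.weight_two_of_newform_coeff_bound`.

The unconditional Hecke bound `|μ| ≤ p + 1` (`norm_le_of_hasEigenvalue_heckeT_trivial`) does NOT
suffice: with the distinguishing prime of size `≍ N²` it gives `log η ≲ #c (2 log N + …)`, which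
exceeds Pasten's bound for large `N` (with `x = log N` one would need
`x + log(1 + x) - log 3 < 4x / log x`, false from `x = 44` on).

## Contents (all proved)

* Minimal primes of `𝕋 = anemicHeckeRing N k`: `intCast_mem_of_mem_minimalPrimes_iff` (no nonzero
  integers: minimal primes consist of zero divisors, `𝕋` is `ℤ`-free),
  `free_quotient_of_mem_minimalPrimes`, `charZero_quotient_of_mem_minimalPrimes`,
  `finrank_quotient_pos_of_mem_minimalPrimes` (`#c = rank_ℤ 𝕋⧸P ≥ 1`).
* `exists_isNewform0_eigenIdeal_eq_of_mem_minimalPrimes` — **the minimal primes of `𝕋` are the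
  eigen-ideals of the Atkin–Lehner forms `[α_d]_k g`, `g` a newform of level `M`, `M d ∣ N`**
  (Pasten §4.11 "classes of systems of eigenvalues"; by the spanning half of the Atkin–Lehner
  decomposition, `iSup_atkinLehnerComponent_eq_top`, `span_newforms0_holds`, finiteness of the
  family and prime avoidance); this is step (1).
* `exists_sieve_primes`, `IsNewform0.coeff_eq_of_coprime_of_lt`,
  `IsNewform0.coeff_eq_of_coprime_of_forall_prime_lt_sturm` — step (2) with the level `N rad N`
  (iterating Atkin–Lehner's sieve `f ↦ f - ι_q U_q f`, `qExpansion_coeff_sub_iota_heckeT`, and the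
  cuspidal Sturm bound `cuspForm_eq_zero_of_qExpansion_coeff_eq_zero`): newforms `f` (level `N`)
  and `g` (level `M ∣ N`) with `a_p(f) = a_p(g)` for all primes `p ∤ N` below
  `⌊k μ(N rad N)/12⌋ + 1` have `a_n(f) = a_n(g)` for all `(n, N) = 1`; and
  `gamma0Index_mul_prod_primeFactors` (`μ(N rad N) = N ∏_{p ∣ N}(p + 1)`),
  `prod_primeFactors_add_one_le` (`∏_{p ∣ N}(p + 1) ≤ N (1 + log N)`, via the tree's
  `Sieve.prod_primeFactors_one_add_inv_le`, `Sieve.sum_divisors_inv_le`: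
  `∏ (1 + 1/p) ≤ ∑_{d ∣ N} 1/d ≤ H_N ≤ 1 + log N`). The distinguishing index is taken PRIME (the
  first index prime to `N` where two normalised eigenforms differ is a prime, by the Hecke
  recursions), so Robin's divisor bound of step (4) is not needed (`d(p) = 2`).
* `heckeCongruenceModulus_le_pow_finrank(_of_ringHom)` — step (3) in the form
  **`η_{[χ₀]}(P) ≤ (B + |χ₀(t)|)^{#c}`** whenever `t - χ₀(t) ∉ P` and `t` satisfies an integer
  polynomial with complex roots of absolute value `≤ B`: with `s` the characteristic polynomial of
  multiplication by `t - χ₀(t)` on the free `ℤ`-module `𝕋 ⧸ P` (rank `#c`), `s(t - χ₀(t)) ∈ P`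
  (Cayley–Hamilton), `η ∣ χ₀(s(t - χ₀(t))) = s(0) = ± N_{(𝕋⧸P)/ℤ}(t - χ₀(t)) ≠ 0` (Prop. 5.4,
  `heckeCongruenceModulus_dvd_of_mem`; `Algebra.norm_ne_zero_iff`), and `|s(0)|` is the product of
  the complex roots of `s` (`isRoot_of_isRoot_charpoly_lmul`: they are roots of every integer
  polynomial vanishing at `t - χ₀(t)`).
* `exists_monic_aeval_heckeT_eq_zero(_norm_le)` — **`T_p` satisfies a monic integer polynomial all
  of whose complex roots are (up to complex conjugation) eigenvalues of `T_p` on `S_k(Γ₀(N))`**: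
  the characteristic polynomial of the integer matrix of `T_p` on the Hecke-stable lattice of
  `exists_heckeStable_realBasis` (Shimura Thm. 3.48); a complex eigenvector `z` of that matrix
  yields the `T_p`-eigenvectors `∑ zⱼ bⱼ` (for `μ`) and `∑ z̄ⱼ bⱼ` (for `μ̄`), not both zero. This
  replaces "the Galois conjugates of `a_p(g)` are eigenvalues" in step (3).
* `log_four_sub_add_half_log_lt` — step (4): `log 4 - ½ log 6 + ½ log(1 + x) < 4x / log x` for
  `x = log N > 1`, whence `#c log(4√p) < #c (log N + 4 log N / log log N)` for `p ≤ N²(1+log N)/6`.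

## References

* H. Pasten, *Shimura curves and the abc conjecture*, J. Number Theory 254 (2024), 214–335,
  doi:10.1016/j.jnt.2023.07.002 = arXiv:1705.09251: §4.11 (p. 16), Prop. 5.4 (p. 17), proof of
  Thm. 7.2 (p. 26). [PastenShimura2024]
* P. Deligne, *La conjecture de Weil. I*, Publ. Math. IHÉS 43 (1974), Thm. 8.2. [Deligne1974]
* A. O. L. Atkin, J. Lehner, *Hecke operators on `Γ₀(m)`*, Math. Ann. 185 (1970), Thms. 3, 5.
  [AtkinLehner1970]
* J. Sturm, *On the congruence of modular forms*, LNM 1240 (1987), Thm. 1. [Sturm1987]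
* G. Shimura, *Introduction to the arithmetic theory of automorphic functions* (1971), Prop. 1.43,
  Thm. 3.48. [Shimura1971] [ShimuraIATAF1971]
* F. Diamond, J. Shurman, *A first course in modular forms*, GTM 228 (2005), Prop. 5.8.5.
  [DiamondShurman2005]
-/

noncomputable section

open scoped MatrixGroups ModularForm ComplexConjugate nonZeroDivisors

open CongruenceSubgroup UpperHalfPlane Polynomial

namespace Literature.NumberTheory.EllipticCurves.ModularForms

/-! ### Minimal primes of `𝕋`: no nonzero integers, torsion-free quotients of positive rank -/

section MinimalPrimes

variable {N : ℕ} [NeZero N] {k : ℤ}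

/-- The Hecke ring `𝕋 ⊆ End_ℂ(S_k(Γ₀(N)))` is a torsion-free `ℤ`-module. [folklore] -/
theorem isTorsionFree_anemicHeckeRing : Module.IsTorsionFree ℤ (anemicHeckeRing N k) := by
  haveI : IsAddTorsionFree (Module.End ℂ (CuspForm (Gamma0 N) k)) :=
    IsAddTorsionFree.of_isTorsionFree ℂ _
  exact Subtype.val_injective.moduleIsTorsionFree
    (fun x : anemicHeckeRing N k ↦ (x : Module.End ℂ (CuspForm (Gamma0 N) k))) (fun _ _ ↦ rfl)

/-- A nonzero integer is a nonzerodivisor of the Hecke ring `𝕋`. [folklore] -/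
theorem intCast_mem_nonZeroDivisors_anemicHeckeRing {n : ℤ} (hn : n ≠ 0) :
    ((n : anemicHeckeRing N k) : anemicHeckeRing N k) ∈ (anemicHeckeRing N k)⁰ := by
  haveI := isTorsionFree_anemicHeckeRing (N := N) (k := k)
  rw [mem_nonZeroDivisors_iff_right]
  intro t ht
  rw [mul_comm, ← zsmul_eq_mul, smul_eq_zero] at ht
  exact ht.resolve_left hn

/-- **A minimal prime of `𝕋` contains no nonzero integer** (minimal primes consist of zero
divisors, and `𝕋` is `ℤ`-torsion-free). [folklore] -/
theorem intCast_mem_of_mem_minimalPrimes_iff {P : Ideal (anemicHeckeRing N k)}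
    (hP : P ∈ minimalPrimes (anemicHeckeRing N k)) (n : ℤ) :
    (n : anemicHeckeRing N k) ∈ P ↔ n = 0 := by
  refine ⟨fun h ↦ ?_, fun h ↦ by rw [h, Int.cast_zero]; exact P.zero_mem⟩
  by_contra hn
  exact Set.disjoint_left.mp (Ideal.disjoint_nonZeroDivisors_of_mem_minimalPrimes hP) h
    (intCast_mem_nonZeroDivisors_anemicHeckeRing hn)

/-- The quotient of `𝕋` by any ideal is a finitely generated `ℤ`-module. [folklore] -/
theorem finite_quotient_anemicHeckeRing (P : Ideal (anemicHeckeRing N k)) :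
    Module.Finite ℤ (anemicHeckeRing N k ⧸ P) :=
  Module.Finite.of_surjective (Ideal.Quotient.mkₐ ℤ P).toLinearMap (Ideal.Quotient.mkₐ_surjective ℤ P)

/-- The quotient of `𝕋` by a minimal prime is a torsion-free `ℤ`-module. [folklore] -/
theorem isTorsionFree_quotient_of_mem_minimalPrimes {P : Ideal (anemicHeckeRing N k)}
    (hP : P ∈ minimalPrimes (anemicHeckeRing N k)) :
    Module.IsTorsionFree ℤ (anemicHeckeRing N k ⧸ P) := by
  haveI : P.IsPrime := hP.1.1
  refine Module.IsTorsionFree.of_smul_eq_zero fun n x hnx ↦ ?_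
  rw [zsmul_eq_mul, mul_eq_zero] at hnx
  rcases hnx with h | h
  · left
    rw [← map_intCast (Ideal.Quotient.mk P), Ideal.Quotient.eq_zero_iff_mem] at h
    exact (intCast_mem_of_mem_minimalPrimes_iff hP n).mp h
  · exact Or.inr h

/-- The quotient of `𝕋` by a minimal prime is a free `ℤ`-module (finitely generated and
torsion-free). [folklore] -/
theorem free_quotient_of_mem_minimalPrimes {P : Ideal (anemicHeckeRing N k)}
    (hP : P ∈ minimalPrimes (anemicHeckeRing N k)) :
    Module.Free ℤ (anemicHeckeRing N k ⧸ P) := by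
  haveI := isTorsionFree_quotient_of_mem_minimalPrimes hP
  haveI := finite_quotient_anemicHeckeRing P
  exact Module.free_of_finite_type_torsion_free'

/-- The quotient of `𝕋` by a minimal prime has characteristic zero. [folklore] -/
theorem charZero_quotient_of_mem_minimalPrimes {P : Ideal (anemicHeckeRing N k)}
    (hP : P ∈ minimalPrimes (anemicHeckeRing N k)) :
    CharZero (anemicHeckeRing N k ⧸ P) := by
  refine ⟨fun m n hmn ↦ ?_⟩
  have h : (((m : ℤ) - (n : ℤ) : ℤ) : anemicHeckeRing N k ⧸ P) = 0 := by
    push_cast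
    rw [hmn, sub_self]
  rw [← map_intCast (Ideal.Quotient.mk P), Ideal.Quotient.eq_zero_iff_mem,
    intCast_mem_of_mem_minimalPrimes_iff hP, sub_eq_zero] at h
  exact_mod_cast h

/-- **`#c ≥ 1`**: the quotient of `𝕋` by a minimal prime has positive `ℤ`-rank (it is a
nontrivial torsion-free finitely generated `ℤ`-module). [folklore] -/
theorem finrank_quotient_pos_of_mem_minimalPrimes {P : Ideal (anemicHeckeRing N k)}
    (hP : P ∈ minimalPrimes (anemicHeckeRing N k)) :
    0 < Module.finrank ℤ (anemicHeckeRing N k ⧸ P) := by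
  haveI : P.IsPrime := hP.1.1
  haveI := isTorsionFree_quotient_of_mem_minimalPrimes hP
  haveI := finite_quotient_anemicHeckeRing P
  haveI : Nontrivial (anemicHeckeRing N k ⧸ P) := Ideal.Quotient.nontrivial_iff.mpr hP.1.1.ne_top
  exact Module.finrank_pos

end MinimalPrimes

/-! ### Integer matrices: complex roots of the characteristic polynomial -/

section IntMatrix

variable {ι : Type*} [Fintype ι] [DecidableEq ι]

/-- A complex root `μ` of the characteristic polynomial of an integer matrix `A` is an eigenvalue
of `A` on `ℂ^ι`: `A z = μ z` for some `z ≠ 0`. [folklore] -/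
theorem exists_mulVec_eq_smul_of_isRoot_charpoly (A : Matrix ι ι ℤ) {μ : ℂ}
    (hμ : (A.charpoly.map (Int.castRingHom ℂ)).IsRoot μ) :
    ∃ z : ι → ℂ, z ≠ 0 ∧ (A.map (Int.castRingHom ℂ)).mulVec z = μ • z := by
  set Aℂ : Matrix ι ι ℂ := A.map (Int.castRingHom ℂ) with hAℂ
  have hchar : (Matrix.toLin' Aℂ).charpoly = A.charpoly.map (Int.castRingHom ℂ) := by
    rw [← Matrix.charpoly_map, ← LinearMap.charpoly_toMatrix (Matrix.toLin' Aℂ) (Pi.basisFun ℂ ι),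
      LinearMap.toMatrix_eq_toMatrix', LinearMap.toMatrix'_toLin']
  have hev : Module.End.HasEigenvalue (Matrix.toLin' Aℂ) μ := by
    rw [Module.End.hasEigenvalue_iff_isRoot_charpoly, hchar]
    exact hμ
  obtain ⟨z, hz⟩ := hev.exists_hasEigenvector
  exact ⟨z, hz.2, by rw [← Matrix.toLin'_apply]; exact hz.apply_eq_smul⟩

/-- If an integer matrix `A` satisfies `q(A) = 0` and `A z = μ z` with `z ≠ 0` over `ℂ`, then
`q(μ) = 0`. [folklore] -/
theorem eval_map_eq_zero_of_aeval_eq_zero_of_mulVec_eq_smul (A : Matrix ι ι ℤ) {q : ℤ[X]}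
    (hq : aeval A q = 0) {μ : ℂ} {z : ι → ℂ} (hz : z ≠ 0)
    (hAz : (A.map (Int.castRingHom ℂ)).mulVec z = μ • z) :
    (q.map (Int.castRingHom ℂ)).eval μ = 0 := by
  set Aℂ : Matrix ι ι ℂ := A.map (Int.castRingHom ℂ) with hAℂ
  have hqℂ : aeval Aℂ (q.map (Int.castRingHom ℂ)) = 0 := by
    have h := Polynomial.map_aeval_eq_aeval_map (R := ℤ) (S := Matrix ι ι ℤ) (T := ℂ)
      (U := Matrix ι ι ℂ) (φ := Int.castRingHom ℂ) (ψ := (Int.castRingHom ℂ).mapMatrix)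
      (Subsingleton.elim _ _) q A
    rw [hq, map_zero] at h
    exact h.symm
  have hvec : Module.End.HasEigenvector (Matrix.toLinAlgEquiv' Aℂ) μ z :=
    ⟨Module.End.mem_eigenspace_iff.mpr (by rw [Matrix.toLinAlgEquiv'_apply, hAz]), hz⟩
  have h := Module.End.aeval_apply_of_hasEigenvector (p := q.map (Int.castRingHom ℂ)) hvec
  rw [Polynomial.aeval_algEquiv, AlgHom.comp_apply, AlgEquiv.coe_toAlgHom, hqℂ, map_zero,
    LinearMap.zero_apply, eq_comm, smul_eq_zero] at h
  exact h.resolve_right hz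

/-- **The complex roots of the characteristic polynomial of multiplication by `x` are roots of
every integer polynomial vanishing at `x`.** For a commutative ring `O` which is a free `ℤ`-module
of finite rank, `x ∈ O` and `q ∈ ℤ[X]` with `q(x) = 0`: every complex root of the characteristic
polynomial of `y ↦ x y` on `O` is a root of `q`. [folklore] -/
theorem isRoot_of_isRoot_charpoly_lmul {O : Type*} [CommRing O] [Module.Free ℤ O]
    [Module.Finite ℤ O] (x : O) {q : ℤ[X]} (hq : aeval x q = 0) {μ : ℂ}
    (hμ : ((Algebra.lmul ℤ O x).charpoly.map (Int.castRingHom ℂ)).IsRoot μ) :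
    (q.map (Int.castRingHom ℂ)).IsRoot μ := by
  classical
  let b := Module.Free.chooseBasis ℤ O
  set A : Matrix _ _ ℤ := LinearMap.toMatrix b b (Algebra.lmul ℤ O x) with hA
  have hchar : (Algebra.lmul ℤ O x).charpoly = A.charpoly :=
    (LinearMap.charpoly_toMatrix (Algebra.lmul ℤ O x) b).symm
  rw [hchar] at hμ
  obtain ⟨z, hz, hAz⟩ := exists_mulVec_eq_smul_of_isRoot_charpoly A hμ
  have hqA : aeval A q = 0 := by
    have h1 : aeval (LinearMap.toMatrixAlgEquiv b (Algebra.lmul ℤ O x)) q = 0 := by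
      rw [Polynomial.aeval_algHom_apply (LinearMap.toMatrixAlgEquiv b) (Algebra.lmul ℤ O x) q,
        Polynomial.aeval_algHom_apply (Algebra.lmul ℤ O) x q, hq, map_zero, map_zero]
    exact h1
  exact eval_map_eq_zero_of_aeval_eq_zero_of_mulVec_eq_smul A hqA hz hAz

/-- The norm of a product of complex numbers each of norm at most `B ≥ 0` is at most
`B ^ (number of factors)`. [folklore] -/
theorem norm_multisetProd_le_pow {s : Multiset ℂ} {B : ℝ} (hB : 0 ≤ B)
    (h : ∀ μ ∈ s, ‖μ‖ ≤ B) : ‖s.prod‖ ≤ B ^ Multiset.card s := by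
  induction s using Multiset.induction_on with
  | empty => simp
  | cons a s ih =>
    rw [Multiset.prod_cons, norm_mul, Multiset.card_cons, pow_succ']
    exact mul_le_mul (h a (Multiset.mem_cons_self a s))
      (ih fun μ hμ ↦ h μ (Multiset.mem_cons_of_mem hμ)) (norm_nonneg _) hB

/-- If all complex roots of a monic integer polynomial `s` have norm at most `B ≥ 0`, then
`|s(0)| ≤ B ^ deg s`. [folklore] -/
theorem abs_coeff_zero_le_pow_of_roots_le {s : ℤ[X]} (hs : s.Monic) {B : ℝ} (hB : 0 ≤ B)
    (h : ∀ μ : ℂ, (s.map (Int.castRingHom ℂ)).IsRoot μ → ‖μ‖ ≤ B) :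
    |(s.coeff 0 : ℝ)| ≤ B ^ s.natDegree := by
  set sℂ := s.map (Int.castRingHom ℂ) with hsℂ
  have hmon : sℂ.Monic := hs.map _
  have hsplit : sℂ.Splits := IsAlgClosed.splits sℂ
  have hdeg : sℂ.natDegree = s.natDegree := hs.natDegree_map _
  have h0 : (s.coeff 0 : ℂ) = (-1) ^ sℂ.natDegree * sℂ.roots.prod := by
    rw [← hsplit.coeff_zero_eq_prod_roots_of_monic hmon, hsℂ, Polynomial.coeff_map, eq_intCast]
  have hnorm : ‖(s.coeff 0 : ℂ)‖ ≤ B ^ s.natDegree := by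
    rw [h0, norm_mul, norm_pow, norm_neg, norm_one, one_pow, one_mul, ← hdeg,
      hsplit.natDegree_eq_card_roots]
    exact norm_multisetProd_le_pow hB fun μ hμ ↦ h μ ((Polynomial.mem_roots hmon.ne_zero).mp hμ)
  rwa [Complex.norm_intCast] at hnorm

end IntMatrix

/-! ### `T_p` satisfies a monic integer polynomial whose complex roots are eigenvalues -/

section IntegerPolynomial

/-- Polynomials in an operator with an integer matrix on a family of vectors: if
`T bⱼ = ∑ᵢ Aᵢⱼ bᵢ` then `q(T) bⱼ = ∑ᵢ q(A)ᵢⱼ bᵢ` for every `q ∈ ℤ[X]`. [folklore] -/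
theorem aeval_apply_eq_sum_of_apply_eq_sum {V : Type*} [AddCommGroup V] [Module ℂ V] {n : ℕ}
    (b : Fin n → V) (T : Module.End ℂ V) (A : Matrix (Fin n) (Fin n) ℤ)
    (hT : ∀ j, T (b j) = ∑ i, ((A i j : ℤ) : ℂ) • b i) (q : ℤ[X]) (j : Fin n) :
    aeval T q (b j) = ∑ i, ((aeval A q i j : ℤ) : ℂ) • b i := by
  induction q using Polynomial.induction_on generalizing j with
  | C a =>
    simp only [Polynomial.aeval_C, Matrix.algebraMap_matrix_apply, algebraMap_int_eq,
      Int.coe_castRingHom, Module.End.intCast_apply]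
    rw [Finset.sum_eq_single j (fun i _ hij ↦ by rw [if_neg hij, Int.cast_zero, zero_smul])
      (fun hj ↦ (hj (Finset.mem_univ j)).elim), if_pos rfl]
    exact (Int.cast_smul_eq_zsmul ℂ a (b j)).symm
  | add p q hp hq =>
    simp only [map_add, LinearMap.add_apply, hp, hq, Matrix.add_apply, Int.cast_add, add_smul,
      Finset.sum_add_distrib]
  | monomial m a h =>
    have hmat : aeval A (C a * X ^ (m + 1)) = aeval A (C a * X ^ m) * A := by
      rw [pow_succ, ← mul_assoc, map_mul, Polynomial.aeval_X]
    have hop : aeval T (C a * X ^ (m + 1)) = aeval T (C a * X ^ m) * T := by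
      rw [pow_succ, ← mul_assoc, map_mul, Polynomial.aeval_X]
    rw [hop, hmat, Module.End.mul_apply, hT, map_sum]
    simp_rw [map_smul, h, Finset.smul_sum, smul_smul, Matrix.mul_apply, Int.cast_sum,
      Int.cast_mul, Finset.sum_smul]
    rw [Finset.sum_comm]
    refine Finset.sum_congr rfl fun i _ ↦ Finset.sum_congr rfl fun l _ ↦ ?_
    rw [mul_comm]

variable (N : ℕ) [NeZero N] (k : ℤ)

/-- **`T_p` on `S_k(Γ₀(N))` is annihilated by a monic integer polynomial all of whose complex
roots are, up to complex conjugation, eigenvalues of `T_p`.** Take the characteristic polynomial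
of the integer matrix of `T_p` on a `T_p`-stable full lattice (Shimura 1971, Thm. 3.48:
`exists_heckeStable_realBasis`, the `ℤ`-span of an `ℝ`-basis `b` of `S_k(Γ₀(N))`): by
Cayley–Hamilton it kills `T_p`, and a complex eigenvector `z` of the matrix gives the vectors
`∑ zⱼ bⱼ` and `∑ z̄ⱼ bⱼ`, eigenvectors of `T_p` for `μ` and `μ̄`, not both zero.
[cite: Shimura1971, Thm. 3.48] -/
theorem exists_monic_aeval_heckeT_eq_zero (p : ℕ) [NeZero p] (hp : p.Prime) :
    ∃ q : ℤ[X], q.Monic ∧ aeval (heckeT (Gamma0 N) k p) q = 0 ∧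
      ∀ μ : ℂ, (q.map (Int.castRingHom ℂ)).IsRoot μ →
        Module.End.HasEigenvalue (heckeT (Gamma0 N) k p) μ ∨
          Module.End.HasEigenvalue (heckeT (Gamma0 N) k p) (conj μ) := by
  obtain ⟨n, b, hb⟩ := exists_heckeStable_realBasis N k
  set T : Module.End ℂ (CuspForm (Gamma0 N) k) := heckeT (Gamma0 N) k p with hT
  have hcol : ∀ j : Fin n, ∃ c : Fin n → ℤ, ∑ i, c i • b i = T (b j) := fun j ↦
    (Submodule.mem_span_range_iff_exists_fun ℤ).mp (hb p hp j)
  choose c hc using hcol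
  obtain ⟨A, hTb⟩ : ∃ A : Matrix (Fin n) (Fin n) ℤ, ∀ j, T (b j) = ∑ i, ((A i j : ℤ) : ℂ) • b i := by
    refine ⟨Matrix.of fun i j ↦ c j i, fun j ↦ ?_⟩
    rw [← hc j]
    refine Finset.sum_congr rfl fun i _ ↦ ?_
    rw [Matrix.of_apply, Int.cast_smul_eq_zsmul]
  refine ⟨A.charpoly, A.charpoly_monic, ?_, fun μ hμ ↦ ?_⟩
  · -- Cayley–Hamilton on the lattice, then extend `ℝ`-linearly
    have hbj : ∀ j, aeval T A.charpoly (b j) = 0 := fun j ↦ by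
      rw [aeval_apply_eq_sum_of_apply_eq_sum b T A hTb, Matrix.aeval_self_charpoly]
      simp
    refine LinearMap.ext fun v ↦ ?_
    rw [LinearMap.zero_apply, ← b.sum_repr v, map_sum (aeval T A.charpoly)]
    refine Finset.sum_eq_zero fun j _ ↦ ?_
    rw [(aeval T A.charpoly).map_smul_of_tower (b.repr v j) (b j), hbj, smul_zero]
  · obtain ⟨z, hz0, hz⟩ := exists_mulVec_eq_smul_of_isRoot_charpoly A hμ
    have hzi : ∀ i, ∑ j, ((A i j : ℤ) : ℂ) * z j = μ * z i := fun i ↦ by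
      have := congrFun hz i
      simpa [Matrix.mulVec, dotProduct, Matrix.map_apply] using this
    -- the two candidate eigenvectors
    set v : CuspForm (Gamma0 N) k := ∑ j, z j • b j with hv
    set v' : CuspForm (Gamma0 N) k := ∑ j, conj (z j) • b j with hv'
    have hTv : T v = μ • v := by
      rw [hv, map_sum, Finset.smul_sum]
      simp_rw [map_smul, hTb, Finset.smul_sum, smul_smul]
      rw [Finset.sum_comm]
      refine Finset.sum_congr rfl fun i _ ↦ ?_
      rw [← Finset.sum_smul, ← hzi i]
      congr 1
      exact Finset.sum_congr rfl fun j _ ↦ mul_comm _ _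
    have hTv' : T v' = conj μ • v' := by
      rw [hv', map_sum, Finset.smul_sum]
      simp_rw [map_smul, hTb, Finset.smul_sum, smul_smul]
      rw [Finset.sum_comm]
      refine Finset.sum_congr rfl fun i _ ↦ ?_
      rw [← Finset.sum_smul, ← map_mul, ← hzi i, map_sum]
      congr 1
      exact Finset.sum_congr rfl fun j _ ↦ by rw [map_mul, map_intCast, mul_comm]
    by_cases hv0 : v = 0
    · by_cases hv'0 : v' = 0
      · -- both vanish: then `z = 0`
        exfalso
        apply hz0
        have hind := Fintype.linearIndependent_iff.mp b.linearIndependent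
        have hre : ∀ j, 2 * (z j).re = 0 := by
          refine hind (fun j ↦ 2 * (z j).re) ?_
          have : v + v' = 0 := by rw [hv0, hv'0, add_zero]
          rw [hv, hv', ← Finset.sum_add_distrib] at this
          rw [← this]
          refine Finset.sum_congr rfl fun j _ ↦ ?_
          rw [← add_smul, Complex.add_conj, Complex.coe_smul]
        have him : ∀ j, 2 * (z j).im = 0 := by
          refine hind (fun j ↦ 2 * (z j).im) ?_
          have : v - v' = 0 := by rw [hv0, hv'0, sub_zero]
          rw [hv, hv', ← Finset.sum_sub_distrib] at this
          have hI : Complex.I • ∑ j, (2 * (z j).im) • b j = 0 := by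
            rw [← this, Finset.smul_sum]
            refine Finset.sum_congr rfl fun j _ ↦ ?_
            rw [← sub_smul, Complex.sub_conj, ← Complex.coe_smul, smul_smul, mul_comm]
          exact (smul_eq_zero.mp hI).resolve_left Complex.I_ne_zero
        funext j
        apply Complex.ext
        · simpa using hre j
        · simpa using him j
      · exact Or.inr (Module.End.hasEigenvalue_of_hasEigenvector
          ⟨Module.End.mem_eigenspace_iff.mpr hTv', hv'0⟩)
    · exact Or.inl (Module.End.hasEigenvalue_of_hasEigenvector
        ⟨Module.End.mem_eigenspace_iff.mpr hTv, hv0⟩)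

/-- **Norm form**: `T_p` (any prime `p`) satisfies a monic `q ∈ ℤ[X]` all of whose complex roots
have absolute value at most any common bound `B` for the eigenvalues of `T_p` on `S_k(Γ₀(N))`.
[folklore] -/
theorem exists_monic_aeval_heckeT_eq_zero_norm_le (p : ℕ) [NeZero p] (hp : p.Prime) {B : ℝ}
    (hB : ∀ μ : ℂ, Module.End.HasEigenvalue (heckeT (Gamma0 N) k p) μ → ‖μ‖ ≤ B) :
    ∃ q : ℤ[X], q.Monic ∧ aeval (heckeT (Gamma0 N) k p) q = 0 ∧
      ∀ μ : ℂ, (q.map (Int.castRingHom ℂ)).IsRoot μ → ‖μ‖ ≤ B := by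
  obtain ⟨q, hq, hq0, hroots⟩ := exists_monic_aeval_heckeT_eq_zero N k p hp
  refine ⟨q, hq, hq0, fun μ hμ ↦ ?_⟩
  rcases hroots μ hμ with h | h
  · exact hB μ h
  · rw [← Complex.norm_conj]
    exact hB _ h

end IntegerPolynomial

/-! ### The size of `η`: Prop. 5.4 applied to a characteristic polynomial -/

section EtaBound

variable {N : ℕ} [NeZero N] {k : ℤ}

/-- **`η_{[χ₀]}(P) ≤ (B + |χ₀(t)|)^{#c}`, abstract form.** Let `f ≠ 0` have integral eigen-system
`χ₀ : 𝕋 → ℤ`, let `π : 𝕋 → O` be a ring map to an integral domain `O` which is a free `ℤ`-module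
of finite rank `#c`, with kernel `P`, and let `t ∈ 𝕋` with `t - χ₀(t) ∉ P`
(the systems `χ₀` and `π` differ at `t`). If `t` satisfies an integer polynomial `q` all of whose
complex roots have absolute value `≤ B`, then `η_{[χ₀]}(P) ≤ (B + |χ₀(t)|)^{#c}`. This is the
mechanism of Pasten 2024, proof of Thm. 7.2 (p. 26), with the characteristic polynomial `s` of
multiplication by `x = π(t) - χ₀(t)` on `O` in place of the minimal polynomial of `χ(T_n)`:
`s(t - χ₀(t)) ∈ P` (Cayley–Hamilton), so `η ∣ χ₀(s(t - χ₀(t))) = s(0)` (Prop. 5.4,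
`heckeCongruenceModulus_dvd_of_mem`), `s(0) = ± N_{O/ℤ}(x) ≠ 0`, and `|s(0)|` is the product of
the `#c` complex roots of `s`, each of the form `μ - χ₀(t)` with `q(μ) = 0`.
[cite: PastenShimura2024, proof of Thm. 7.2, p. 26] -/
theorem heckeCongruenceModulus_le_pow_finrank_of_ringHom {O : Type*} [CommRing O] [IsDomain O]
    [Module.Free ℤ O] [Module.Finite ℤ O] {f : CuspForm (Gamma0 N) k}
    (hf : HasIntegralEigenvalues f) (hf0 : f ≠ 0) {P : Ideal (anemicHeckeRing N k)}
    (π : anemicHeckeRing N k →+* O) (hπ : RingHom.ker π = P) {t : anemicHeckeRing N k}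
    (ht : t - (intEigencharacter hf hf0 t : anemicHeckeRing N k) ∉ P) {q : ℤ[X]}
    (hq : aeval t q = 0) {B : ℝ} (hB : 0 ≤ B)
    (hroot : ∀ μ : ℂ, (q.map (Int.castRingHom ℂ)).IsRoot μ → ‖μ‖ ≤ B) :
    (heckeCongruenceModulus f P : ℝ) ≤
      (B + |(intEigencharacter hf hf0 t : ℝ)|) ^ Module.finrank ℤ O := by
  set χ := intEigencharacter hf hf0 with hχ
  set a : ℤ := χ t with ha
  set x : O := π (t - (a : anemicHeckeRing N k)) with hx
  set s : ℤ[X] := (Algebra.lmul ℤ O x).charpoly with hs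
  -- (1) `s(x) = 0` in `O` (Cayley–Hamilton), so `s(t - a) ∈ ker π = P`
  have hsx : aeval x s = 0 := by
    have h := LinearMap.aeval_self_charpoly (Algebra.lmul ℤ O x)
    rw [← hs, Polynomial.aeval_algHom_apply (Algebra.lmul ℤ O) x s] at h
    exact Algebra.lmul_injective (h.trans (map_zero _).symm)
  have hmem : aeval (t - (a : anemicHeckeRing N k)) s ∈ P := by
    have h1 := Polynomial.aeval_algHom_apply π.toIntAlgHom (t - (a : anemicHeckeRing N k)) s
    simp only [RingHom.toIntAlgHom_coe] at h1
    rw [← hπ, RingHom.mem_ker, ← h1, ← hx]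
    exact hsx
  -- (2) `η ∣ χ₀(s(t - a)) = s(0)`
  have hdvd : (heckeCongruenceModulus f P : ℤ) ∣ s.coeff 0 := by
    have h := heckeCongruenceModulus_dvd_of_mem hf hf0 (P := P) hmem
    have hval : χ (aeval (t - (a : anemicHeckeRing N k)) s) = s.coeff 0 := by
      have h1 := Polynomial.aeval_algHom_apply χ.toIntAlgHom (t - (a : anemicHeckeRing N k)) s
      simp only [RingHom.toIntAlgHom_coe] at h1
      rw [map_sub, map_intCast, ← ha, Int.cast_id, sub_self,
        ← Polynomial.coeff_zero_eq_aeval_zero', Algebra.algebraMap_self, RingHom.id_apply] at h1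
      exact h1.symm
    rwa [hval] at h
  -- (3) `s(0) = ± N(x) ≠ 0` since `x ≠ 0` in the domain `O`
  have hx0 : x ≠ 0 := by
    rw [hx, Ne, ← RingHom.mem_ker, hπ]
    exact ht
  have hcoeff : s.coeff 0 ≠ 0 := by
    intro h0
    have hdet := LinearMap.det_eq_sign_charpoly_coeff (Algebra.lmul ℤ O x)
    rw [← hs, h0, mul_zero, ← Algebra.norm_apply] at hdet
    exact Algebra.norm_ne_zero_iff.mpr hx0 hdet
  -- (4) `η ≤ |s(0)|`
  have hη : (heckeCongruenceModulus f P : ℝ) ≤ |(s.coeff 0 : ℝ)| := by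
    have h1 : heckeCongruenceModulus f P ≤ (s.coeff 0).natAbs :=
      Nat.le_of_dvd (Int.natAbs_pos.mpr hcoeff) (Int.natCast_dvd.mp hdvd)
    calc (heckeCongruenceModulus f P : ℝ) ≤ ((s.coeff 0).natAbs : ℝ) := by exact_mod_cast h1
      _ = |(s.coeff 0 : ℝ)| := by rw [Nat.cast_natAbs, Int.cast_abs]
  -- (5) the complex roots of `s` are `μ - a` with `q(μ) = 0`
  have hroots : ∀ μ : ℂ, (s.map (Int.castRingHom ℂ)).IsRoot μ → ‖μ‖ ≤ B + |(a : ℝ)| := by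
    intro μ hμ
    have hxa : x + algebraMap ℤ O a = π t := by
      rw [hx, map_sub, map_intCast, algebraMap_int_eq, Int.coe_castRingHom, sub_add_cancel]
    have hq' : aeval x (q.comp (X + C a)) = 0 := by
      have h1 := Polynomial.aeval_algHom_apply π.toIntAlgHom t q
      simp only [RingHom.toIntAlgHom_coe] at h1
      rw [Polynomial.aeval_comp, map_add, Polynomial.aeval_X, Polynomial.aeval_C, hxa, h1, hq,
        map_zero]
    have hr := isRoot_of_isRoot_charpoly_lmul x hq' hμ
    rw [Polynomial.IsRoot, Polynomial.map_comp, Polynomial.eval_comp, Polynomial.map_add,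
      Polynomial.map_X, Polynomial.map_C, Polynomial.eval_add, Polynomial.eval_X,
      Polynomial.eval_C, eq_intCast] at hr
    have hB' := hroot (μ + a) hr
    calc ‖μ‖ = ‖(μ + a) - a‖ := by rw [add_sub_cancel_right]
      _ ≤ ‖μ + a‖ + ‖(a : ℂ)‖ := norm_sub_le _ _
      _ ≤ B + |(a : ℝ)| := by rw [Complex.norm_intCast]; gcongr
  -- (6) `|s(0)| ≤ (B + |a|)^{deg s}` and `deg s = rank O`
  have hdeg : s.natDegree = Module.finrank ℤ O := LinearMap.charpoly_natDegree _
  have hle := abs_coeff_zero_le_pow_of_roots_le (LinearMap.charpoly_monic _) (by positivity) hroots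
  rw [hdeg] at hle
  exact hη.trans hle

/-- **`η_{[χ₀]}(P) ≤ (B + |χ₀(t)|)^{#c}`** for a minimal prime `P` of `𝕋`, `#c = rank_ℤ(𝕋 ⧸ P)`:
the case `O = 𝕋 ⧸ P` of `heckeCongruenceModulus_le_pow_finrank_of_ringHom` (a domain, free of
finite rank over `ℤ` since `P` is a minimal prime: `free_quotient_of_mem_minimalPrimes`).
[cite: PastenShimura2024, proof of Thm. 7.2, p. 26] -/
theorem heckeCongruenceModulus_le_pow_finrank {f : CuspForm (Gamma0 N) k}
    (hf : HasIntegralEigenvalues f) (hf0 : f ≠ 0) {P : Ideal (anemicHeckeRing N k)}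
    (hP : P ∈ minimalPrimes (anemicHeckeRing N k)) {t : anemicHeckeRing N k}
    (ht : t - (intEigencharacter hf hf0 t : anemicHeckeRing N k) ∉ P) {q : ℤ[X]}
    (hq : aeval t q = 0) {B : ℝ} (hB : 0 ≤ B)
    (hroot : ∀ μ : ℂ, (q.map (Int.castRingHom ℂ)).IsRoot μ → ‖μ‖ ≤ B) :
    (heckeCongruenceModulus f P : ℝ) ≤
      (B + |(intEigencharacter hf hf0 t : ℝ)|) ^ Module.finrank ℤ (anemicHeckeRing N k ⧸ P) := by
  haveI : P.IsPrime := hP.1.1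
  haveI := free_quotient_of_mem_minimalPrimes hP
  haveI := finite_quotient_anemicHeckeRing P
  exact heckeCongruenceModulus_le_pow_finrank_of_ringHom hf hf0 (Ideal.Quotient.mk P)
    Ideal.mk_ker ht hq hB hroot

end EtaBound

/-! ### Minimal primes of `𝕋` are the eigen-ideals of the Atkin–Lehner eigenforms -/

section Newforms

variable (N : ℕ) [NeZero N] (k : ℤ)

/-- The Atkin–Lehner index set `{(M, d) : M d ∣ N}` is finite. [folklore] -/
theorem finite_atkinLehnerIndex : Finite (AtkinLehnerIndex N) := by
  have h : {x : ℕ × ℕ | x.1 * x.2 ∣ N}.Finite := by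
    refine (Finset.finite_toSet (Finset.range (N + 1) ×ˢ Finset.range (N + 1))).subset ?_
    intro x hx
    have h1 : x.1 ∣ N := (dvd_mul_right _ _).trans hx
    have h2 : x.2 ∣ N := (dvd_mul_left _ _).trans hx
    simp only [Finset.coe_product, Finset.coe_range, Set.mem_prod, Set.mem_Iio]
    exact ⟨Nat.lt_succ_of_le (Nat.le_of_dvd (NeZero.pos N) h1),
      Nat.lt_succ_of_le (Nat.le_of_dvd (NeZero.pos N) h2)⟩
  exact h.to_subtype

variable {N k}

/-- **The Atkin–Lehner forms `[α_d]_k g` are `T_p`-eigenvectors with eigenvalue `a_p(g)`**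
(`p ∤ N`; `g` a newform of level `M`, `M d ∣ N`): `T_p` commutes with `[α_d]_k`
(`heckeT_degeneracyMap0`) and `T_p g = a_p(g) g` (`IsNewform0.heckeT_eq_coeff_smul`)
(Atkin–Lehner 1970, Thm. 3; Diamond–Shurman Prop. 5.6.2 with Prop. 5.8.5).
[cite: AtkinLehner1970, Thm. 3] -/
theorem heckeT_degeneracyMap0_eq_coeff_smul (x : AtkinLehnerIndex N) {g : CuspForm (Gamma0 x.1.1) k}
    (hg : IsNewform0 g) (p : ℕ) [NeZero p] (hp : p.Prime) (hpN : ¬ p ∣ N) :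
    heckeT (Gamma0 N) k p (degeneracyMap0 x.1.1 N x.1.2 k g) =
      (qExpansion 1 ⇑g).coeff p • degeneracyMap0 x.1.1 N x.1.2 k g := by
  rw [heckeT_degeneracyMap0 x.2 hp hpN g, hg.heckeT_eq_coeff_smul hp, map_smul]

/-- The Atkin–Lehner forms `[α_d]_k g` are simultaneous eigenvectors of the `T_p`, `p ∤ N`.
[folklore] -/
theorem isAnemicEigenvector_degeneracyMap0 (x : AtkinLehnerIndex N)
    {g : CuspForm (Gamma0 x.1.1) k} (hg : IsNewform0 g) :
    IsAnemicEigenvector (degeneracyMap0 x.1.1 N x.1.2 k g) := fun p hp hpN ↦ by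
  haveI : NeZero p := ⟨hp.ne_zero⟩
  exact ⟨(qExpansion 1 ⇑g).coeff p, heckeT_degeneracyMap0_eq_coeff_smul x hg p hp hpN⟩

/-- For a nonzero `T_p`-eigenvector `φ` with eigenvalue `c` and an integer `a`:
`T_p - a ∈ 𝕀_{[χ_φ]}` iff `c = a`. [folklore] -/
theorem T_sub_intCast_mem_eigenIdeal_iff {φ : CuspForm (Gamma0 N) k} (hφ0 : φ ≠ 0) {p : ℕ}
    [NeZero p] (hp : p.Prime) (hpN : ¬ p ∣ N) {c : ℂ} (hc : heckeT (Gamma0 N) k p φ = c • φ)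
    (a : ℤ) :
    anemicHeckeRing.T N k p hp hpN - (a : anemicHeckeRing N k) ∈ eigenIdeal φ ↔ c = a := by
  rw [mem_eigenIdeal, Subalgebra.coe_sub, LinearMap.sub_apply, anemicHeckeRing.coe_T, hc,
    SubringClass.coe_intCast, Module.End.intCast_apply, ← Int.cast_smul_eq_zsmul ℂ, ← sub_smul,
    smul_eq_zero, sub_eq_zero, or_iff_left hφ0]

/-- Two nonzero simultaneous eigenvectors with the same `T_p`-eigenvalues for all `p ∤ N` have
the same eigen-ideal (their eigencharacters agree on the generators of `𝕋 = ℤ[T_p : p ∤ N]`).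
[folklore] -/
theorem eigenIdeal_eq_of_forall_heckeT_eq_smul {φ ψ : CuspForm (Gamma0 N) k}
    (hφ : IsAnemicEigenvector φ) (hφ0 : φ ≠ 0) (hψ : IsAnemicEigenvector ψ) (hψ0 : ψ ≠ 0)
    (h : ∀ (p : ℕ) (hp : p.Prime), ¬ p ∣ N → ∃ c : ℂ,
      (haveI : NeZero p := ⟨hp.ne_zero⟩; heckeT (Gamma0 N) k p φ) = c • φ ∧
        (haveI : NeZero p := ⟨hp.ne_zero⟩; heckeT (Gamma0 N) k p ψ) = c • ψ) :
    eigenIdeal φ = eigenIdeal ψ := by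
  have hχ' : eigencharacter hφ hφ0 = eigencharacter hψ hψ0 := by
    refine RingHom.ext fun t ↦ ?_
    obtain ⟨t, ht⟩ := t
    induction ht using Algebra.adjoin_induction with
    | mem x hx =>
      obtain ⟨p, hp, hpN, rfl⟩ := hx
      obtain ⟨c, hcφ, hcψ⟩ := h p hp hpN
      exact (eigencharacter_eq_of_apply_eq_smul hφ hφ0 hcφ).trans
        (eigencharacter_eq_of_apply_eq_smul hψ hψ0 hcψ).symm
    | algebraMap r =>
      have hr : ∀ (ξ : CuspForm (Gamma0 N) k),
          (algebraMap ℤ (Module.End ℂ (CuspForm (Gamma0 N) k)) r) ξ = ((r : ℤ) : ℂ) • ξ := fun ξ ↦ by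
        rw [Algebra.algebraMap_eq_smul_one, LinearMap.smul_apply, Module.End.one_apply,
          Int.cast_smul_eq_zsmul]
      exact (eigencharacter_eq_of_apply_eq_smul hφ hφ0 (hr φ)).trans
        (eigencharacter_eq_of_apply_eq_smul hψ hψ0 (hr ψ)).symm
    | add x y hx hy hx' hy' =>
      have : (⟨x + y, add_mem hx hy⟩ : anemicHeckeRing N k) = ⟨x, hx⟩ + ⟨y, hy⟩ := rfl
      rw [this, map_add, map_add, hx', hy']
    | mul x y hx hy hx' hy' =>
      have : (⟨x * y, mul_mem hx hy⟩ : anemicHeckeRing N k) = ⟨x, hx⟩ * ⟨y, hy⟩ := rfl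
      rw [this, map_mul, map_mul, hx', hy']
  rw [eigenIdeal_eq_ker_eigencharacter hφ hφ0, eigenIdeal_eq_ker_eigencharacter hψ hψ0, hχ']

/-- **The minimal primes of `𝕋` are the eigen-ideals `𝕀_{[χ_g]}` of the newforms `g` of the
levels `M ∣ N`** (Pasten 2024, §4.9–4.11: the classes of systems of Hecke eigenvalues on
`𝕋_{1,N}` ↔ the kernels `𝕀_{[χ]}`; here via the Atkin–Lehner decomposition, Atkin–Lehner 1970,
Thm. 5): for every minimal prime `P` of `𝕋` there are `M d ∣ N` and a newform
`g ∈ S_k(Γ₀(M))` with `[α_d]_k g ≠ 0` and `P = 𝕀_{[χ]}`, `χ` the system of `[α_d]_k g`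
(`χ(T_p) = a_p(g)`, `p ∤ N`). Proof: the forms `[α_d]_k g` span `S_k(Γ₀(N))`
(`iSup_atkinLehnerComponent_eq_top`, `span_newforms0_holds`) and are finitely many, so the
intersection of their eigen-ideals is `0 ⊆ P`, whence one of them lies in the prime `P`
(prime avoidance) and equals it by minimality. [cite: PastenShimura2024, §4.11 p. 16]
[cite: AtkinLehner1970, Thm. 5] -/
theorem exists_isNewform0_eigenIdeal_eq_of_mem_minimalPrimes {P : Ideal (anemicHeckeRing N k)}
    (hP : P ∈ minimalPrimes (anemicHeckeRing N k)) :
    ∃ (x : AtkinLehnerIndex N) (g : CuspForm (Gamma0 x.1.1) k), IsNewform0 g ∧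
      degeneracyMap0 x.1.1 N x.1.2 k g ≠ 0 ∧ P = eigenIdeal (degeneracyMap0 x.1.1 N x.1.2 k g) := by
  classical
  haveI : P.IsPrime := hP.1.1
  haveI := finite_atkinLehnerIndex N
  set Φ : Set (CuspForm (Gamma0 N) k) :=
    ⋃ x : AtkinLehnerIndex N, (degeneracyMap0 x.1.1 N x.1.2 k) '' newforms0 x.1.1 k with hΦ
  have hΦfin : Φ.Finite := Set.finite_iUnion fun x ↦ (finite_newforms0_holds x.1.1 k).image _
  -- `Φ` spans `S_k(Γ₀(N))`
  have hspan : Submodule.span ℂ Φ = ⊤ := by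
    rw [hΦ, Submodule.span_iUnion, ← iSup_atkinLehnerComponent_eq_top k N]
    refine iSup_congr fun x ↦ ?_
    rw [atkinLehnerComponent, ← span_newforms0_holds x.1.1 k, Submodule.span_image]
  -- the infimum of the eigen-ideals over `Φ` is `0 ⊆ P`
  have hinf : hΦfin.toFinset.inf eigenIdeal ≤ P := by
    intro t ht
    rw [Submodule.mem_finsetInf] at ht
    have ht0 : (t : Module.End ℂ (CuspForm (Gamma0 N) k)) = 0 := by
      refine LinearMap.ext fun v ↦ ?_
      rw [LinearMap.zero_apply]
      have hv : v ∈ Submodule.span ℂ Φ := by rw [hspan]; exact Submodule.mem_top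
      refine Submodule.span_induction
        (p := fun v _ ↦ (t : Module.End ℂ (CuspForm (Gamma0 N) k)) v = 0) (fun φ hφ ↦ ?_)
        (map_zero _) (fun u w _ _ hu hw ↦ by rw [map_add, hu, hw, add_zero])
        (fun c w _ hw ↦ by rw [map_smul, hw, smul_zero]) hv
      exact mem_eigenIdeal.mp (ht φ (hΦfin.mem_toFinset.mpr hφ))
    have ht0' : t = 0 := Subtype.ext (by rw [ht0]; rfl)
    rw [ht0']
    exact P.zero_mem
  obtain ⟨φ, hφΦ, hle⟩ := (Ideal.IsPrime.inf_le' hP.1.1).mp hinf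
  rw [Set.Finite.mem_toFinset, hΦ, Set.mem_iUnion] at hφΦ
  obtain ⟨x, g, hg, rfl⟩ := hφΦ
  have hφ0 : degeneracyMap0 x.1.1 N x.1.2 k g ≠ 0 := by
    intro h0
    rw [h0, eigenIdeal_zero, top_le_iff] at hle
    exact hP.1.1.ne_top hle
  refine ⟨x, g, hg, hφ0, le_antisymm (hP.2 ⟨isPrime_eigenIdeal
    (isAnemicEigenvector_degeneracyMap0 x hg) hφ0, bot_le⟩ hle) hle⟩

end Newforms

/-! ### Sieving out the primes of the level and the Sturm bound: a distinguishing prime -/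

section Distinguish

variable {k : ℤ}

/-- **Iterated sieve.** For a finite set `S` of primes dividing `L` and `h ∈ S_k(Γ₀(L))` there is
a form `H ∈ S_k(Γ₀(L ∏_{q ∈ S} q))` with `a_n(H) = a_n(h)` if no prime of `S` divides `n` and
`a_n(H) = 0` otherwise: iterate Atkin–Lehner's sieve `f ↦ f - ι_q U_q f` (level `× q`,
`qExpansion_coeff_sub_iota_heckeT`). This is the passage `f ↦ F` ("deleting the Fourier
coefficients of index not coprime to `N`", of level dividing `N²`) in Pasten 2024, proof of
Thm. 7.2, p. 26, with the level `N rad(N)`. [cite: PastenShimura2024, proof of Thm. 7.2, p. 26] -/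
theorem exists_sieve_primes (S : Finset ℕ) :
    ∀ (L : ℕ) [NeZero L], (∀ q ∈ S, q.Prime ∧ q ∣ L) → ∀ h : CuspForm (Gamma0 L) k,
      ∃ H : CuspForm (Gamma0 (L * ∏ q ∈ S, q)) k, ∀ n : ℕ,
        (qExpansion 1 ⇑H).coeff n =
          if ∀ q ∈ S, ¬ q ∣ n then (qExpansion 1 ⇑h).coeff n else 0 := by
  induction S using Finset.induction_on with
  | empty =>
    intro L _ _ h
    refine ⟨toLevel0 (dvd_mul_right L _) k h, fun n ↦ ?_⟩
    rw [qExpansion_toLevel0, if_pos (by simp)]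
  | insert p S hpS ih =>
    intro L _ hS h
    have hp : p.Prime := (hS p (Finset.mem_insert_self p S)).1
    have hpL : p ∣ L := (hS p (Finset.mem_insert_self p S)).2
    haveI : Fact p.Prime := ⟨hp⟩
    obtain ⟨H₁, hH₁⟩ := ih L (fun q hq ↦ hS q (Finset.mem_insert_of_mem hq)) h
    have hL₁ : L * ∏ q ∈ S, q ≠ 0 := mul_ne_zero (NeZero.ne L)
      (Finset.prod_ne_zero_iff.mpr fun q hq ↦ (hS q (Finset.mem_insert_of_mem hq)).1.ne_zero)
    haveI : NeZero (L * ∏ q ∈ S, q) := ⟨hL₁⟩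
    have hL : L * ∏ q ∈ insert p S, q = (L * ∏ q ∈ S, q) * p := by
      rw [Finset.prod_insert hpS]; ring
    have hpL₁ : p ∣ L * ∏ q ∈ S, q := hpL.mul_right _
    refine ⟨toLevel0 ⟨p, hL⟩ k H₁ - iota (L * ∏ q ∈ S, q) (L * ∏ q ∈ insert p S, q) p k
      (hL ▸ dvd_rfl) (heckeT (Gamma0 (L * ∏ q ∈ S, q)) k p H₁), fun n ↦ ?_⟩
    rw [qExpansion_coeff_sub_iota_heckeT k p hL (hL ▸ dvd_rfl) hpL₁ H₁ n, hH₁ n]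
    by_cases hpn : p ∣ n
    · rw [if_pos hpn, if_neg (fun hall ↦ hall p (Finset.mem_insert_self p S) hpn)]
    · rw [if_neg hpn]
      by_cases hall : ∀ q ∈ S, ¬ q ∣ n
      · rw [if_pos hall, if_pos (fun q hq ↦ ?_)]
        rcases Finset.mem_insert.mp hq with rfl | hq'
        · exact hpn
        · exact hall q hq'
      · rw [if_neg hall, if_neg (fun h' ↦ hall fun q hq ↦ h' q (Finset.mem_insert_of_mem hq))]

variable {N : ℕ} [NeZero N]

/-- **Truncated Hecke recursion.** Newforms `f` (level `N`) and `g` (level `M ∣ N`) with the same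
`a_p` at the primes `p ∤ N` below `B` have the same `a_n` at all `n < B` prime to `N`
(Diamond–Shurman Prop. 5.8.5: `a_{pm} = a_p a_m - 𝟙(p) p^{k-1} a_{m/p}`,
`IsNewform0.coeff_prime_mul`). [cite: DiamondShurman2005, Prop. 5.8.5] -/
theorem IsNewform0.coeff_eq_of_coprime_of_lt {M : ℕ} [NeZero M] {f : CuspForm (Gamma0 N) k}
    {g : CuspForm (Gamma0 M) k} (hf : IsNewform0 f) (hg : IsNewform0 g) (hMN : M ∣ N) {B : ℕ}
    (h : ∀ p : ℕ, p.Prime → ¬ p ∣ N → p < B →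
      (qExpansion 1 ⇑f).coeff p = (qExpansion 1 ⇑g).coeff p)
    {n : ℕ} (hn : n.Coprime N) (hnB : n < B) :
    (qExpansion 1 ⇑f).coeff n = (qExpansion 1 ⇑g).coeff n := by
  induction n using Nat.strong_induction_on with
  | _ n ih =>
    rcases Nat.lt_or_ge n 2 with hn2 | hn2
    · interval_cases n
      · rw [CuspFormClass.qExpansion_coeff_zero f one_pos (one_mem_strictPeriods_gamma0 N),
          CuspFormClass.qExpansion_coeff_zero g one_pos (one_mem_strictPeriods_gamma0 M)]
      · rw [show (qExpansion 1 ⇑f).coeff 1 = 1 from hf.2.2,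
          show (qExpansion 1 ⇑g).coeff 1 = 1 from hg.2.2]
    · obtain ⟨p, hp, m, rfl⟩ : ∃ p, p.Prime ∧ ∃ m, n = p * m := by
        obtain ⟨p, hp, hpn⟩ := Nat.exists_prime_and_dvd (show n ≠ 1 by omega)
        exact ⟨p, hp, hpn⟩
      have hpN : ¬ p ∣ N :=
        (Nat.Prime.coprime_iff_not_dvd hp).mp (Nat.Coprime.coprime_dvd_left (dvd_mul_right p m) hn)
      have hpM : ¬ p ∣ M := fun h' ↦ hpN (h'.trans hMN)
      have hm : m.Coprime N := Nat.Coprime.coprime_mul_left hn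
      have hm0 : 0 < m := Nat.pos_of_ne_zero (by rintro rfl; simp at hn2)
      have hmlt : m < p * m := lt_mul_left hm0 hp.one_lt
      have hpB : p < B := lt_of_le_of_lt (Nat.le_mul_of_pos_right p hm0) hnB
      rw [hf.coeff_prime_mul hp m, hg.coeff_prime_mul hp m, if_neg hpN, if_neg hpM, h p hp hpN hpB,
        ih m hmlt hm (hmlt.trans hnB)]
      split_ifs with hpm
      · rw [ih (m / p) ((Nat.div_le_self m p).trans_lt hmlt)
          (Nat.Coprime.coprime_dvd_left (Nat.div_dvd_of_dvd hpm) hm)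
          (((Nat.div_le_self m p).trans_lt hmlt).trans hnB)]
      · rfl

/-- `n` is prime to `N ≠ 0` iff no prime factor of `N` divides `n`. [folklore] -/
theorem coprime_iff_forall_mem_primeFactors_not_dvd {n : ℕ} :
    n.Coprime N ↔ ∀ q ∈ N.primeFactors, ¬ q ∣ n := by
  constructor
  · intro h q hq hqn
    exact (Nat.prime_of_mem_primeFactors hq).one_lt.ne'
      (Nat.Coprime.eq_one_of_dvd (Nat.Coprime.coprime_dvd_left hqn h)
        (Nat.dvd_of_mem_primeFactors hq))
  · intro h
    by_contra hc
    obtain ⟨q, hq, hqn, hqN⟩ := Nat.Prime.not_coprime_iff_dvd.mp hc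
    exact h q (Nat.mem_primeFactors.mpr ⟨hq, hqN, NeZero.ne N⟩) hqn

/-- `Γ₀(L)` has at least one cusp: `ν_∞(L) ≥ 1`. [folklore] -/
theorem one_le_nuInfty (L : ℕ) [NeZero L] : 1 ≤ nuInfty L := by
  unfold nuInfty
  have h := Finset.single_le_sum (f := fun d ↦ Nat.totient (Nat.gcd d (L / d)))
    (fun _ _ ↦ Nat.zero_le _) (Nat.one_mem_divisors.mpr (NeZero.ne L))
  simpa using h

/-- **Quantitative multiplicity one, prime to the level** (the Sturm-bound step of Pasten 2024,
proof of Thm. 7.2, p. 26: "the Fourier expansions of `F` and `G` differ at some index bounded by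
…"). Let `f ∈ S_k(Γ₀(N))` and `g ∈ S_k(Γ₀(M))`, `M ∣ N`, be newforms whose coefficients `a_p`
agree at every prime `p ∤ N` below `B = ⌊k μ(N rad N)/12⌋ + 1`, `μ = [SL₂(ℤ) : Γ₀(N rad N)]`
(`gamma0Index`, `rad N = ∏_{p ∣ N} p`). Then `a_n(f) = a_n(g)` for **all** `n` prime to `N`:
the sieved difference `H = ∑_{(n,N)=1} (a_n(f) - a_n(g)) qⁿ ∈ S_k(Γ₀(N rad N))`
(`exists_sieve_primes`) has `a_n(H) = 0` for `n < B` (`IsNewform0.coeff_eq_of_coprime_of_lt`),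
hence vanishes by the cuspidal Sturm bound (`cuspForm_eq_zero_of_qExpansion_coeff_eq_zero`,
Sturm 1987, Thm. 1, with `index_gamma0_eq_gamma0Index_holds`). [cite: PastenShimura2024, proof of Thm. 7.2, p. 26]
[cite: Sturm1987, Thm. 1] -/
theorem IsNewform0.coeff_eq_of_coprime_of_forall_prime_lt_sturm {M : ℕ} [NeZero M]
    {f : CuspForm (Gamma0 N) k} {g : CuspForm (Gamma0 M) k} (hf : IsNewform0 f)
    (hg : IsNewform0 g) (hMN : M ∣ N)
    (h : ∀ p : ℕ, p.Prime → ¬ p ∣ N →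
      p < (k * gamma0Index (N * ∏ q ∈ N.primeFactors, q)).toNat / 12 + 1 →
      (qExpansion 1 ⇑f).coeff p = (qExpansion 1 ⇑g).coeff p)
    {n : ℕ} (hn : n.Coprime N) :
    (qExpansion 1 ⇑f).coeff n = (qExpansion 1 ⇑g).coeff n := by
  set L := N * ∏ q ∈ N.primeFactors, q with hL
  have hL0 : L ≠ 0 := mul_ne_zero (NeZero.ne N)
    (Finset.prod_ne_zero_iff.mpr fun q hq ↦ (Nat.prime_of_mem_primeFactors hq).ne_zero)
  haveI : NeZero L := ⟨hL0⟩
  set d : CuspForm (Gamma0 N) k := f - toLevel0 hMN k g with hd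
  have hdcoeff : ∀ m, (qExpansion 1 ⇑d).coeff m =
      (qExpansion 1 ⇑f).coeff m - (qExpansion 1 ⇑g).coeff m := fun m ↦ by
    rw [hd, qExpansion_coeff_sub_level0, qExpansion_toLevel0]
  obtain ⟨H, hH⟩ := exists_sieve_primes (k := k) N.primeFactors N
    (fun q hq ↦ ⟨Nat.prime_of_mem_primeFactors hq, Nat.dvd_of_mem_primeFactors hq⟩) d
  -- `a_i(H) = 0` for `i < B`
  have hHB : ∀ i < (k * gamma0Index L).toNat / 12 + 1, (qExpansion 1 ⇑H).coeff i = 0 := by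
    intro i hi
    rw [hH i]
    split_ifs with hcop
    · rw [hdcoeff, hf.coeff_eq_of_coprime_of_lt hg hMN h
        ((coprime_iff_forall_mem_primeFactors_not_dvd (N := N)).mpr hcop) hi, sub_self]
    · rfl
  -- Sturm at level `L = N rad N`
  have hH0 : H = 0 := by
    refine cuspForm_eq_zero_of_qExpansion_coeff_eq_zero (one_mem_strictPeriods_coe_gamma0 L) H
      hHB ?_
    rw [card_quotient_subgroupOf_eq_index, index_gamma0_eq_gamma0Index_holds L]
    have hc : Nat.card (CuspOrbits (Gamma0 L : Subgroup (GL (Fin 2) ℝ))) = nuInfty L :=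
      numCusps_eq_nuInfty_holds L
    rw [hc]
    have h1 := one_le_nuInfty L
    omega
  have key := hH n
  rw [hH0, if_pos ((coprime_iff_forall_mem_primeFactors_not_dvd (N := N)).mp hn), hdcoeff]
    at key
  have h0 : (qExpansion 1 ⇑(0 : CuspForm (Gamma0 L) k)).coeff n = 0 := by
    simp [CuspForm.coe_zero, qExpansion_zero]
  rw [h0] at key
  exact (sub_eq_zero.mp key.symm)

end Distinguish

/-! ### The index of `Γ₀(N rad N)` and the bound `∏_{p ∣ N} (p + 1) ≤ N (1 + log N)` -/

section Index

/-- **`[SL₂(ℤ) : Γ₀(N rad N)] = N ∏_{p ∣ N} (p + 1)`** (`rad N = ∏_{p ∣ N} p`), from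
`μ(L) = ∏_{p^e ∥ L} p^{e-1}(p + 1)` (Shimura Prop. 1.43) with `e_p(N rad N) = e_p(N) + 1`.
[cite: ShimuraIATAF1971, Prop. 1.43] -/
theorem gamma0Index_mul_prod_primeFactors {N : ℕ} (hN : N ≠ 0) :
    gamma0Index (N * ∏ p ∈ N.primeFactors, p) = N * ∏ p ∈ N.primeFactors, (p + 1) := by
  set R := ∏ p ∈ N.primeFactors, p with hR
  have hR0 : R ≠ 0 :=
    Finset.prod_ne_zero_iff.mpr fun p hp ↦ (Nat.prime_of_mem_primeFactors hp).ne_zero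
  have hRfac : R.factorization = ∑ p ∈ N.primeFactors, Finsupp.single p 1 := by
    rw [hR, Nat.factorization_prod fun p hp ↦ (Nat.prime_of_mem_primeFactors hp).ne_zero]
    exact Finset.sum_congr rfl fun p hp ↦ (Nat.prime_of_mem_primeFactors hp).factorization
  have hRfac' : ∀ p ∈ N.primeFactors, R.factorization p = 1 := by
    intro p hp
    rw [hRfac, Finset.sum_apply', Finset.sum_eq_single p (fun q _ hqp ↦ by
      rw [Finsupp.single_apply, if_neg hqp]) (fun h ↦ (h hp).elim), Finsupp.single_eq_same]
  have hRpf : R.primeFactors = N.primeFactors :=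
    Nat.primeFactors_prod fun p hp ↦ Nat.prime_of_mem_primeFactors hp
  have hsupp : (N * R).factorization.support = N.primeFactors := by
    rw [Nat.support_factorization, Nat.primeFactors_mul hN hR0, hRpf, Finset.union_idempotent]
  unfold gamma0Index
  rw [Finsupp.prod, hsupp, Nat.factorization_mul hN hR0]
  simp only [Finsupp.coe_add, Pi.add_apply]
  rw [Finset.prod_mul_distrib]
  congr 1
  conv_rhs => rw [← Nat.prod_factorization_pow_eq_self hN]
  rw [Finsupp.prod, Nat.support_factorization]
  refine Finset.prod_congr rfl fun p hp ↦ ?_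
  rw [hRfac' p hp, Nat.add_sub_cancel]

/-- **`∏_{p ∣ N} (p + 1) ≤ N (1 + log N)`** (`∏ (p+1) = rad(N) ∏ (1 + 1/p) ≤ N ∑_{d ∣ N} 1/d ≤
N (1 + log N)`, the last two steps being the tree's `Sieve.prod_primeFactors_one_add_inv_le` and
`Sieve.sum_divisors_inv_le`; Pasten 2024, proof of Thm. 7.2: `∏_{p ∣ N}(1 + 1/p) ≤ 1 + log N`).
[cite: PastenShimura2024, proof of Thm. 7.2, p. 26] -/
theorem prod_primeFactors_add_one_le {N : ℕ} (hN : N ≠ 0) :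
    (∏ p ∈ N.primeFactors, (p + 1) : ℕ) ≤ (N : ℝ) * (1 + Real.log N) := by
  have hrad : (∏ p ∈ N.primeFactors, p : ℕ) ≤ N := Nat.le_of_dvd (Nat.pos_of_ne_zero hN)
    (Nat.prod_primeFactors_dvd N)
  have hsplit : ((∏ p ∈ N.primeFactors, (p + 1) : ℕ) : ℝ) =
      (∏ p ∈ N.primeFactors, p : ℕ) * ∏ p ∈ N.primeFactors, (1 + (p : ℝ)⁻¹) := by
    push_cast
    rw [← Finset.prod_mul_distrib]
    refine Finset.prod_congr rfl fun p hp ↦ ?_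
    have hp0 : (p : ℝ) ≠ 0 := by exact_mod_cast (Nat.prime_of_mem_primeFactors hp).ne_zero
    field_simp
  rw [hsplit]
  have hlog : 0 ≤ 1 + Real.log N :=
    add_nonneg zero_le_one (Real.log_natCast_nonneg N)
  exact mul_le_mul (by exact_mod_cast hrad)
    ((Literature.NumberTheory.Sieve.prod_primeFactors_one_add_inv_le hN).trans
      (Literature.NumberTheory.Sieve.sum_divisors_inv_le N))
    (Finset.prod_nonneg fun _ _ ↦ by positivity) (Nat.cast_nonneg N)

end Index

/-! ### The numerical endgame -/

section Endgame

/-- **The numerical inequality of the endgame**: for `x = log N > 1`,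
`log 4 - (log 6)/2 + log(1 + x)/2 < 4x / log x`. (Pasten 2024, p. 26, bounds
`(2 d(n_c) n_c^{1/2})^{#c}` by `3.7^{#c log N³ / log log N} N^{#c}`, using `3 log 3.7 < 4`; with a
prime index `n_c = p`, `d(p) = 2`, the chain is `log(4 √p) ≤ log N + (log 4 - ½ log 6 +
½ log(1 + log N))` and `½ log(1 + x) ≤ √(1 + x) - 1 ≤ √x`, `log 4 - ½ log 6 < 1 < √x`,
`log x ≤ 2 √x`.) [cite: PastenShimura2024, proof of Thm. 7.2, p. 26] -/
theorem log_four_sub_add_half_log_lt {x : ℝ} (hx : 1 < x) :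
    Real.log 4 - Real.log 6 / 2 + Real.log (1 + x) / 2 < 4 * x / Real.log x := by
  have hx0 : 0 < x := zero_lt_one.trans hx
  have hlogx : 0 < Real.log x := Real.log_pos hx
  have hsx : 1 < Real.sqrt x := by
    rw [show (1 : ℝ) = Real.sqrt 1 from Real.sqrt_one.symm]
    exact Real.sqrt_lt_sqrt zero_le_one hx
  -- (i) `log(1 + x)/2 ≤ √(1 + x) - 1 ≤ √x`
  have h1 : Real.log (1 + x) / 2 ≤ Real.sqrt x := by
    have hpos : 0 < Real.sqrt (1 + x) := Real.sqrt_pos.mpr (by linarith)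
    have hl := Real.log_le_sub_one_of_pos hpos
    rw [Real.log_sqrt (by linarith)] at hl
    have h2 : Real.sqrt (1 + x) ≤ Real.sqrt x + 1 := by
      rw [Real.sqrt_le_iff]
      refine ⟨by positivity, ?_⟩
      nlinarith [Real.sq_sqrt hx0.le, Real.sqrt_nonneg x]
    linarith
  -- (ii) `log 4 - (log 6)/2 < 1`
  have h2 : Real.log 4 - Real.log 6 / 2 < 1 := by
    have h4 : Real.log 4 = 2 * Real.log 2 := by
      rw [show (4 : ℝ) = 2 ^ 2 by norm_num, Real.log_pow, Nat.cast_ofNat]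
    have h6 : 1 < Real.log 6 := by
      rw [Real.lt_log_iff_exp_lt (by norm_num)]
      exact Real.exp_one_lt_d9.trans (by norm_num)
    have := Real.log_two_lt_d9
    linarith
  -- (iii) `log x ≤ 2 √x`, so `2 √x ≤ 4 x / log x`
  have h3 : Real.log x ≤ 2 * Real.sqrt x := by
    have hl := Real.log_le_sub_one_of_pos (zero_lt_one.trans hsx)
    rw [Real.log_sqrt hx0.le] at hl
    linarith
  have h4 : 2 * Real.sqrt x ≤ 4 * x / Real.log x := by
    rw [le_div_iff₀ hlogx]
    have hxx : Real.sqrt x * Real.sqrt x = x := Real.mul_self_sqrt hx0.le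
    nlinarith [Real.sqrt_nonneg x]
  linarith

end Endgame

/-! ### Assembly: the size bound from Deligne's bound in weight two -/

section Assembly

/-- **Pasten 2024, proof of Thm. 7.2 (p. 26): the size of a congruence modulus, granted the
Hasse–Weil/Deligne bound in weight `2`.** If every eigenvalue `μ` of `T_p` (`p ∤ N` prime) on
`S₂(Γ₀(N))` (all `N ≥ 1`) satisfies `|μ| ≤ 2 √p` — the weight-`2` case of Deligne's Thm. 8.2
(Eichler–Shimura–Igusa–Weil), in the tree the unproved named fact
`Deligne1974_heckeT_eigenvalue_norm_le` specialised by
`Deligne1974_heckeT_eigenvalue_norm_le.weight_two` — then, for an elliptic curve of conductor `N`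
with newform `f = D.f` and system `χ₀ = χ_{1,N}`, and any class `c ≠ [χ₀]` of systems of Hecke
eigenvalues on `𝕋_{1,N}`: *"So we get `log η_{[χ_{D,M}]}(c) < #c · (log N + 4 log N / log log N)`"*
(the displayed estimate of the printed proof, obtained there from Prop. 5.4 with the minimal
polynomial of `χ(T_{n_c})`, `n_c < N³` the least index coprime to `N` separating `c` from `χ₀`,
the Hasse–Weil bound and Robin's divisor bound). Reading (module docstring of
`PastenSpectralDegree.lean`): `#c`, the number of systems in the class = the degree of the field
generated by the values of `χ ∈ c` (§4.11), is the `ℤ`-rank of `𝕋 ⧸ 𝕀_c ≅ χ(𝕋)`; the class `c` is a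
minimal prime `P ≠ eigenIdeal D.f` of `𝕋 = anemicHeckeRing N 2`; `D` is any datum of the curve at
level `N`; and `N ≥ 11` (proof of Cor. 5.3, "as `N ≥ 11`"). Proof, following Pasten: `P = 𝕀_{[χ]}`
for the system `χ` of an Atkin–Lehner form `[α_d]_k g`, `g` a newform of level `M ∣ N`
(`exists_isNewform0_eigenIdeal_eq_of_mem_minimalPrimes`); a prime `p ∤ N`,
`p ≤ μ(N rad N)/6 ≤ N²(1 + log N)/6`, with `a_p(f) ≠ a_p(g)` exists
(`IsNewform0.coeff_eq_of_coprime_of_forall_prime_lt_sturm`; otherwise `P = 𝕀_{[χ₀]}`);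
`η ≤ (2√p + |a_p(f)|)^{#c} ≤ (4 √p)^{#c}` (`heckeCongruenceModulus_le_pow_finrank` with the integer
polynomial of `T_p`, `exists_monic_aeval_heckeT_eq_zero_norm_le`, and the bound `2√p`); and
`log(4 √p) < log N + 4 log N / log log N` (`log_four_sub_add_half_log_lt`). (Formerly the discharge
route of the separate named fact `PastenShimura2024_log_heckeCongruenceModulus_lt`, merged into
this theorem's explicit conclusion; module docstring, *History*.)
[cite: PastenShimura2024, proof of Thm. 7.2, p. 26] -/
theorem PastenShimura2024_log_heckeCongruenceModulus_lt_of_weight_two_bound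
    (h2 : ∀ (N : ℕ) [NeZero N] (p : ℕ) [NeZero p], p.Prime → ¬ p ∣ N → ∀ μ : ℂ,
      Module.End.HasEigenvalue (heckeT (Gamma0 N) 2 p) μ → ‖μ‖ ≤ 2 * Real.sqrt p) :
    ∀ (N : ℕ) [NeZero N] (W : WeierstrassCurve ℚ) [W.IsElliptic]
      (D : ModularParametrizationData W N), 11 ≤ N →
        ∀ P ∈ minimalPrimes (anemicHeckeRing N 2), P ≠ eigenIdeal D.f →
          Real.log (heckeCongruenceModulus D.f P) <
            (Module.finrank ℤ (anemicHeckeRing N 2 ⧸ P) : ℝ) *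
              (Real.log N + 4 * Real.log N / Real.log (Real.log N)) := by
  intro N _ W _ D hN P hP hPne
  have hf := D.hasIntegralEigenvalues_f
  have hf0 := D.f_ne_zero
  have hnew : IsNewform0 D.f := D.isNewformOf.1
  -- (1) `P` is the eigen-ideal of an Atkin–Lehner form of a newform `g` of level `M ∣ N`
  obtain ⟨x, g, hg, hφ0, hPφ⟩ := exists_isNewform0_eigenIdeal_eq_of_mem_minimalPrimes hP
  have hMN : x.1.1 ∣ N := (dvd_mul_right _ _).trans x.2
  -- (2) a distinguishing prime `p ∤ N` below the Sturm bound of level `N rad N`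
  have hdist : ∃ p : ℕ, p.Prime ∧ ¬ p ∣ N ∧
      p < ((2 : ℤ) * gamma0Index (N * ∏ q ∈ N.primeFactors, q)).toNat / 12 + 1 ∧
      (qExpansion 1 ⇑D.f).coeff p ≠ (qExpansion 1 ⇑g).coeff p := by
    by_contra hcon
    push Not at hcon
    have hall : ∀ n, n.Coprime N → (qExpansion 1 ⇑D.f).coeff n = (qExpansion 1 ⇑g).coeff n :=
      fun n hn ↦ hnew.coeff_eq_of_coprime_of_forall_prime_lt_sturm hg hMN hcon hn
    have heq : eigenIdeal (degeneracyMap0 x.1.1 N x.1.2 2 g) = eigenIdeal D.f := by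
      refine eigenIdeal_eq_of_forall_heckeT_eq_smul (isAnemicEigenvector_degeneracyMap0 x hg) hφ0
        hf.isAnemicEigenvector hf0 fun p hp hpN ↦ ?_
      haveI : NeZero p := ⟨hp.ne_zero⟩
      refine ⟨(qExpansion 1 ⇑g).coeff p, heckeT_degeneracyMap0_eq_coeff_smul x hg p hp hpN, ?_⟩
      rw [← hall p ((Nat.Prime.coprime_iff_not_dvd hp).mpr hpN)]
      exact hnew.heckeT_eq_coeff_smul hp
    exact hPne (hPφ.trans heq)
  obtain ⟨p, hp, hpN, hpB, hne⟩ := hdist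
  haveI : NeZero p := ⟨hp.ne_zero⟩
  -- (3) `t = T_p`, `a = χ₀(T_p) = a_p(f)`, and `T_p - a ∉ P`
  set t : anemicHeckeRing N 2 := anemicHeckeRing.T N 2 p hp hpN with ht
  set a : ℤ := intEigencharacter hf hf0 t with ha_def
  have ha : (a : ℂ) = (qExpansion 1 ⇑D.f).coeff p := by
    rw [ha_def, cast_intEigencharacter, ht, eigencharacter_T,
      heckeEigenvalue_eq_coeff_of_isNormalized hnew.2.2 hp (hnew.2.1 p hp)]
  have htP : t - (a : anemicHeckeRing N 2) ∉ P := by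
    rw [hPφ, T_sub_intCast_mem_eigenIdeal_iff hφ0 hp hpN
      (heckeT_degeneracyMap0_eq_coeff_smul x hg p hp hpN), ha]
    exact fun h ↦ hne h.symm
  -- (4) the monic integer polynomial killing `T_p`, with roots bounded by `2 √p`
  obtain ⟨q, -, hq0, hroots⟩ := exists_monic_aeval_heckeT_eq_zero_norm_le N 2 p hp
    (fun μ hμ ↦ h2 N p hp hpN μ hμ)
  have hqt : aeval t q = 0 := by
    have h1 := Polynomial.aeval_algHom_apply (anemicHeckeRing N 2).val t q
    rw [Subalgebra.coe_val, ht, anemicHeckeRing.coe_T, hq0] at h1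
    rw [ht]
    exact Subtype.ext (h1.symm.trans (ZeroMemClass.coe_zero _).symm)
  -- (5) `|a| ≤ 2 √p` (Hasse, from the same bound: `f` is a `T_p`-eigenvector with eigenvalue `a`)
  have habs : |(a : ℝ)| ≤ 2 * Real.sqrt p := by
    have hev : Module.End.HasEigenvalue (heckeT (Gamma0 N) 2 p) (a : ℂ) := by
      refine Module.End.hasEigenvalue_of_hasEigenvector ⟨Module.End.mem_eigenspace_iff.mpr ?_, hf0⟩
      rw [← anemicHeckeRing.coe_T N 2 p hp hpN, ← ht, intEigencharacter_spec hf hf0 t]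
    have := h2 N p hp hpN _ hev
    rwa [Complex.norm_intCast] at this
  -- (6) `η ≤ (2 √p + |a|)^{#c} ≤ (4 √p)^{#c}`
  have hη := heckeCongruenceModulus_le_pow_finrank hf hf0 hP htP hqt (by positivity) hroots
  set r := Module.finrank ℤ (anemicHeckeRing N 2 ⧸ P) with hr
  have hr0 : 0 < r := finrank_quotient_pos_of_mem_minimalPrimes hP
  have hp0 : (0 : ℝ) < p := by exact_mod_cast hp.pos
  have hsqrt : 0 < Real.sqrt p := Real.sqrt_pos.mpr hp0
  have hη' : (heckeCongruenceModulus D.f P : ℝ) ≤ (4 * Real.sqrt p) ^ r :=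
    hη.trans (pow_le_pow_left₀ (by positivity) (by linarith) r)
  -- (7) logarithms: `log η ≤ #c log(4 √p) = #c (log 4 + log p / 2)`
  have hηpos : (0 : ℝ) < heckeCongruenceModulus D.f P := by
    exact_mod_cast heckeCongruenceModulus_pos hf hf0 hP hPne
  have hlogη : Real.log (heckeCongruenceModulus D.f P) ≤ r * (Real.log 4 + Real.log p / 2) := by
    have h := Real.log_le_log hηpos hη'
    rwa [Real.log_pow, Real.log_mul (by norm_num) hsqrt.ne', Real.log_sqrt hp0.le] at h
  -- (8) `p ≤ μ(N rad N)/6 = N ∏ (p' + 1) / 6 ≤ N² (1 + log N) / 6`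
  have hNpos : (0 : ℝ) < N := by exact_mod_cast (show 0 < N by omega)
  have hlogN : 1 < Real.log N := by
    rw [Real.lt_log_iff_exp_lt hNpos]
    calc Real.exp 1 < 3 := Real.exp_one_lt_d9.trans (by norm_num)
      _ ≤ N := by exact_mod_cast (show 3 ≤ N by omega)
  have hple : (p : ℝ) ≤ (N : ℝ) ^ 2 * (1 + Real.log N) / 6 := by
    have hμ : gamma0Index (N * ∏ q ∈ N.primeFactors, q) = N * ∏ q ∈ N.primeFactors, (q + 1) :=
      gamma0Index_mul_prod_primeFactors (NeZero.ne N)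
    have hB : ((2 : ℤ) * (gamma0Index (N * ∏ q ∈ N.primeFactors, q) : ℕ)).toNat =
        2 * (N * ∏ q ∈ N.primeFactors, (q + 1)) := by
      rw [hμ, show ((2 : ℤ) * ((N * ∏ q ∈ N.primeFactors, (q + 1) : ℕ) : ℤ)) =
        ((2 * (N * ∏ q ∈ N.primeFactors, (q + 1)) : ℕ) : ℤ) by push_cast; ring, Int.toNat_natCast]
    rw [hB] at hpB
    have hp12 : p ≤ 2 * (N * ∏ q ∈ N.primeFactors, (q + 1)) / 12 := Nat.lt_succ_iff.mp hpB
    have hp6 : 6 * p ≤ N * ∏ q ∈ N.primeFactors, (q + 1) := by omega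
    have hprod := prod_primeFactors_add_one_le (NeZero.ne N)
    have h6 : 6 * (p : ℝ) ≤ (N : ℝ) * ((N : ℝ) * (1 + Real.log N)) := by
      calc 6 * (p : ℝ) = ((6 * p : ℕ) : ℝ) := by push_cast; ring
        _ ≤ ((N * ∏ q ∈ N.primeFactors, (q + 1) : ℕ) : ℝ) := by exact_mod_cast hp6
        _ = (N : ℝ) * ((∏ q ∈ N.primeFactors, (q + 1) : ℕ) : ℝ) := by push_cast; ring
        _ ≤ (N : ℝ) * ((N : ℝ) * (1 + Real.log N)) := by gcongr
    rw [le_div_iff₀ (by norm_num : (0 : ℝ) < 6)]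
    linarith
  -- (9) `log p / 2 ≤ log N + (log(1 + log N) - log 6) / 2`
  have hlogp : Real.log p ≤ 2 * Real.log N + Real.log (1 + Real.log N) - Real.log 6 := by
    have h := Real.log_le_log hp0 hple
    rwa [Real.log_div (by positivity) (by norm_num), Real.log_mul (by positivity) (by positivity),
      Real.log_pow, Nat.cast_ofNat] at h
  -- (10) the endgame
  have hend := log_four_sub_add_half_log_lt hlogN
  have hr' : (0 : ℝ) < r := by exact_mod_cast hr0
  calc Real.log (heckeCongruenceModulus D.f P)
      ≤ r * (Real.log 4 + Real.log p / 2) := hlogη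
    _ ≤ r * (Real.log N + (Real.log 4 - Real.log 6 / 2 + Real.log (1 + Real.log N) / 2)) :=
        mul_le_mul_of_nonneg_left (by linarith) hr'.le
    _ < r * (Real.log N + 4 * Real.log N / Real.log (Real.log N)) :=
        mul_lt_mul_of_pos_left (by linarith) hr'

/-- **Pasten 2024, proof of Thm. 7.2 (p. 26): the size of a congruence modulus, granted the named
fact `Deligne1974_heckeT_eigenvalue_norm_le`** (Deligne's bound `|μ| ≤ 2 p^{(k-1)/2}` for the
eigenvalues of `T_p` on `S_k(Γ₀(N))`; only its weight-`2` case is used): for an elliptic curve of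
conductor `N ≥ 11` with newform `D.f`, and every minimal prime `P ≠ eigenIdeal D.f` of
`𝕋 = anemicHeckeRing N 2` (= every class `c ≠ [χ₀]`, `#c = rank_ℤ(𝕋 ⧸ P)`),
*"`log η_{[χ_{D,M}]}(c) < #c · (log N + 4 log N / log log N)`"*. This is the whole of the tree's debt
for Pasten's displayed estimate: it is exactly one line away from
`Deligne1974_heckeT_eigenvalue_norm_le_holds`. [cite: PastenShimura2024, proof of Thm. 7.2, p. 26]
[cite: Deligne1974, Thm. 8.2 (p. 302)] -/
theorem PastenShimura2024_log_heckeCongruenceModulus_lt_of_deligne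
    (h : Deligne1974_heckeT_eigenvalue_norm_le) :
    ∀ (N : ℕ) [NeZero N] (W : WeierstrassCurve ℚ) [W.IsElliptic]
      (D : ModularParametrizationData W N), 11 ≤ N →
        ∀ P ∈ minimalPrimes (anemicHeckeRing N 2), P ≠ eigenIdeal D.f →
          Real.log (heckeCongruenceModulus D.f P) <
            (Module.finrank ℤ (anemicHeckeRing N 2 ⧸ P) : ℝ) *
              (Real.log N + 4 * Real.log N / Real.log (Real.log N)) :=
  PastenShimura2024_log_heckeCongruenceModulus_lt_of_weight_two_bound
    (fun N _ p _ hp hpN μ hμ ↦ Deligne1974_heckeT_eigenvalue_norm_le.weight_two h N p hp hpN μ hμ)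

/-- **Pasten 2024, proof of Thm. 7.2 (p. 26): the size of a congruence modulus, granted exactly its
printed input — "the Hasse-Weil bound on the Fourier coefficients of a normalized eigenform of
weight `2`".** If every newform `g ∈ S₂(Γ₀(M))` (`M ≥ 1`) satisfies `|a_p(g)| ≤ 2 √p` for all
primes `p ∤ M` — the weight-`2` case of Deligne's Thm. (8.2) (due to Eichler, Shimura and Igusa via
Weil's Riemann hypothesis for curves), which is the only input of the printed proof that the tree
does not prove — then *"`log η_{[χ_{D,M}]}(c) < #c · (log N + 4 log N / log log N)`"* for every
elliptic curve of conductor `N ≥ 11` with newform `D.f` and every minimal prime `P ≠ eigenIdeal D.f`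
of `𝕋 = anemicHeckeRing N 2`: the tree's Atkin–Lehner transport
`Deligne1974_heckeT_eigenvalue_norm_le.weight_two_of_newform_coeff_bound` turns the newform bound
into the eigenvalue bound `h2` of
`PastenShimura2024_log_heckeCongruenceModulus_lt_of_weight_two_bound`. (In the printed proof the
bound is applied to `a_{n_c}(g)` and its conjugates for the newform `g` of the class `c`, of level
dividing `N`; here `n_c` is a prime.) [cite: PastenShimura2024, proof of Thm. 7.2, p. 26]
[cite: Deligne1974, Thm. 8.2 (p. 302)] [cite: AtkinLehner1970, Thm. 5] -/
theorem PastenShimura2024_log_heckeCongruenceModulus_lt_of_hasseWeil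
    (h82 : ∀ (M : ℕ) [NeZero M] (g : CuspForm (Gamma0 M) 2), IsNewform0 g →
      ∀ p : ℕ, p.Prime → ¬ p ∣ M → ‖(qExpansion 1 ⇑g).coeff p‖ ≤ 2 * Real.sqrt p) :
    ∀ (N : ℕ) [NeZero N] (W : WeierstrassCurve ℚ) [W.IsElliptic]
      (D : ModularParametrizationData W N), 11 ≤ N →
        ∀ P ∈ minimalPrimes (anemicHeckeRing N 2), P ≠ eigenIdeal D.f →
          Real.log (heckeCongruenceModulus D.f P) <
            (Module.finrank ℤ (anemicHeckeRing N 2 ⧸ P) : ℝ) *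
              (Real.log N + 4 * Real.log N / Real.log (Real.log N)) :=
  PastenShimura2024_log_heckeCongruenceModulus_lt_of_weight_two_bound
    (Deligne1974_heckeT_eigenvalue_norm_le.weight_two_of_newform_coeff_bound h82)

end Assembly

end Literature.NumberTheory.EllipticCurves.ModularForms

end
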